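import Summits.AtomisticToContinuum.Crystallization.Theorems.FrustratedLawDichotomyStrainedPatchHomForceCentredFinal

/-!
# (C′-2) FORCE/EXEMPT PRUNE, centred form — soundness VI: the one-Boolean leaves `forceOutC` / `forceOutC0`
# (27623 strained-patch piece, hcp half; decomp-a2c hand-2 g28)

Driver-facing wrappers of `…HomForceCentredFinal.forceOutC_sound_of_parts`:
* `check_cert_self` — an accumulator with its guard set passes its own exact certificate `Acc.cert`;
* ★★★ `forceOutC_sound` — `forceOutC en ed sn sd c w cA cB = true` (certificates as leaf payload) ⟹ the `hver` prune disjunct on the box;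
* ★★★ `forceOutC0_sound` — the certificate-free `forceOutC0 en ed sn sd c w = true` ⟹ the same (both family folds in one Boolean; for
  interpreter / `native` drivers and small kernel boxes).
NO definitions; 0 sorry; axioms standard.  `--supports stmt-AtomisticToContinuum-27623`.
-/

namespace Summit.AtomisticToContinuum.Crystallization.Theorems.FrustratedLawDichotomyStrainedPatchHomForceCentredFinal

open scoped BigOperators RealInnerProductSpace
open Literature.Analysis.ValidatedNumerics.Numerics
open Summit.AtomisticToContinuum.Crystallization.Theorems.ChargedEnergyGapNegative (E3)
open Summit.AtomisticToContinuum.Crystallization.Theorems.FrustratedLawDichotomyAveragingRuleTightFree (TightNearCap BadNearCap)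
open Summit.AtomisticToContinuum.Crystallization.Theorems.FrustratedLawDichotomyExemptAbsorption (ExemptNear)
open Summit.AtomisticToContinuum.Crystallization.Theorems.FrustratedLawDichotomyStrainedPatchHomSplit
open Summit.AtomisticToContinuum.Crystallization.Theorems.FrustratedLawDichotomyStrainedPatchHomForceKit (dirVec)
open Summit.AtomisticToContinuum.Crystallization.Theorems.FrustratedLawDichotomyStrainedPatchHomForceSum (dirOK slopeTestOK)
open Summit.AtomisticToContinuum.Crystallization.Theorems.FrustratedLawDichotomyStrainedPatchHomForceCentred

/-- An accumulator whose guard is set passes its own exact certificate. [formal bookkeeping] -/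
theorem check_cert_self {a : Acc} (h : a.ok = true) : a.check a.cert = true := by
  simp [Acc.check, Acc.cert, subAll, subFI, h]

/-- ★★★ **SOUNDNESS OF `forceOutC`** (certificates as leaf payload). [folklore] -/
theorem forceOutC_sound {en : Fin 3 → ℤ} {ed : ℕ} {sn : ℤ} {sd : ℕ} {c w : (Fin 3 × Fin 3) ⊕ Fin 3 → ℤ} {cA cB : FamCert}
    (h : forceOutC en ed sn sd c w cA cB = true)
    (U : E3 →L[ℝ] E3) (ξ : E3) (hU : ‖U - 1‖ ≤ 1 / 4) (hξn : ‖ξ‖ ≤ 1 / 4)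
    (hbox : ∀ ab : Fin 3 × Fin 3, |(U (EuclideanSpace.single ab.2 (1 : ℝ))) ab.1 - (c (Sum.inl ab) : ℝ) / SC| ≤ (w (Sum.inl ab) : ℝ) / SC)
    (hξ : ∀ i : Fin 3, |ξ i - (c (Sum.inr i) : ℝ) / SC| ≤ (w (Sum.inr i) : ℝ) / SC) :
    ∀ (M : ℕ) (z : Fin M → E3) (cc : Fin M), Function.Injective z →
      Set.range z = {x : E3 | dist x (z cc) ≤ 133 / 10 ∧ ∃ a : Fin 3 → ℤ,
        x = z cc + latPt U hexFrame a ∨ x = z cc + latPt U hexFrame a + U (hcpShift + ξ)} →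
      TightNearCap (9 / 5) (3 / 2) z cc ∨ ExemptNear (9 / 5) ExRec z cc ∨ BadNearCap (9 / 5) (3 / 2) z cc := by
  unfold forceOutC at h
  simp only [Bool.and_eq_true, decide_eq_true_eq] at h
  obtain ⟨⟨⟨⟨hdir, hsd⟩, hA⟩, hB⟩, htest⟩ := h
  exact forceOutC_sound_of_parts hdir hsd hA hB htest U ξ hU hξn hbox hξ

/-- ★★★ **SOUNDNESS OF THE CERTIFICATE-FREE LEAF `forceOutC0`**. [folklore] -/
theorem forceOutC0_sound {en : Fin 3 → ℤ} {ed : ℕ} {sn : ℤ} {sd : ℕ} {c w : (Fin 3 × Fin 3) ⊕ Fin 3 → ℤ}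
    (h : forceOutC0 en ed sn sd c w = true)
    (U : E3 →L[ℝ] E3) (ξ : E3) (hU : ‖U - 1‖ ≤ 1 / 4) (hξn : ‖ξ‖ ≤ 1 / 4)
    (hbox : ∀ ab : Fin 3 × Fin 3, |(U (EuclideanSpace.single ab.2 (1 : ℝ))) ab.1 - (c (Sum.inl ab) : ℝ) / SC| ≤ (w (Sum.inl ab) : ℝ) / SC)
    (hξ : ∀ i : Fin 3, |ξ i - (c (Sum.inr i) : ℝ) / SC| ≤ (w (Sum.inr i) : ℝ) / SC) :
    ∀ (M : ℕ) (z : Fin M → E3) (cc : Fin M), Function.Injective z →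
      Set.range z = {x : E3 | dist x (z cc) ≤ 133 / 10 ∧ ∃ a : Fin 3 → ℤ,
        x = z cc + latPt U hexFrame a ∨ x = z cc + latPt U hexFrame a + U (hcpShift + ξ)} →
      TightNearCap (9 / 5) (3 / 2) z cc ∨ ExemptNear (9 / 5) ExRec z cc ∨ BadNearCap (9 / 5) (3 / 2) z cc := by
  obtain ⟨A, hAdef⟩ : ∃ A, famA en ed sn sd c w = A := ⟨_, rfl⟩
  obtain ⟨B, hBdef⟩ : ∃ B, famB en ed sn sd c w = B := ⟨_, rfl⟩
  unfold forceOutC0 at h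
  rw [hAdef, hBdef] at h
  simp only [Bool.and_eq_true, decide_eq_true_eq] at h
  obtain ⟨⟨⟨⟨hdir, hsd⟩, hAok⟩, hBok⟩, htest⟩ := h
  have hA : checkA en ed sn sd c w A.cert = true := by unfold checkA; rw [hAdef]; exact check_cert_self hAok
  have hB : checkB en ed sn sd c w B.cert = true := by unfold checkB; rw [hBdef]; exact check_cert_self hBok
  exact forceOutC_sound_of_parts hdir hsd hA hB htest U ξ hU hξn hbox hξ

end Summit.AtomisticToContinuum.Crystallization.Theorems.FrustratedLawDichotomyStrainedPatchHomForceCentredFinal
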